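import Summits.BirchSwinnertonDyer.Rank1Residual.Additive.KatoDescentRankOnePR
import Literature.NumberTheory.EllipticCurves.Kato2004.ZetaIndexInequalitySkeletonProofs
import HarnessLib

/-!
# The rank-ONE descent `KMC_p(f_E)⁰ ⇒ BSD_p` (and its converse) at an additive potentially good `p ≠ 2`
# under (12.5.2), GRANTED the Perrin-Riou 'Kato point' formula at `p` — kernel assemblies over the
# readings; NO `p`-adic height (cell `bsd-potss`, seat `kmc`; part 4 of the descent files)

HONEST FRAMING (cell `bsd-potss`; memo of record `pub/bsd-potss/bsd-potss-kmc/KMC-DESCENT-MEMO.md` §4):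
nothing asserted; theorems only, every input a hypothesis. Inputs: the rank-`1` schema
`RankOnePRCountReading IsOf` of `Additive/KatoDescentRankOnePR.lean` — which CONTAINS the conjectural
T-O6-A1′ (Perrin-Riou's formula at the additive prime) — together with `DivisibilityReading`,
`Realizable`, `ReadsTrivialKMC` of `Additive/KatoDescentDatum.lean`, Gross–Zagier–Kolyvagin (`hGZK`:
`Ш` finite), the landed descent theorem `Kato2004.index_zeta_eq_natCard_coinvariants_of_conj_12_10` with
its converse, and the landed module-theoretic Thm. 14.5 (3)
`Kato2004.exists_index_zeta_eq_pow_mul_natCard_coinvariants_of_index_ne_zero` (no `L`-value needed).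
OUTPUT: on the (12.5.2) rows of analytic rank `1` at an odd additive potentially good prime,
`KMC⁰(W,p) ⇒ MissingPPartAt W p`, and conversely `MissingLowerBoundAt W p ⇒ D.Conj1210` for every
realised datum whose zeta element survives at the bottom layer (`D.zetaIndex ≠ 0`, Perrin-Riou's
non-vanishing) — T-O6-A (A1) `O6.RankOneOfKMC` in the sharper form "`HtNondeg` idle" on its X4 rows (its
X3 = reducible rows lack (12.5.2) and are NOT covered). What this is NOT: not a proof of the PR formula at
an additive prime (it is inside the schema), not a proof of KMC; nothing at `p = 2`, at a potentially
multiplicative `p`, or without (12.5.2).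
References: K. Kato, Astérisque 295 (2004) Conj. 12.10, Thm. 12.5 (4), Thm. 14.5 (3), (14.9.3), §14.14
[Kato2004Asterisque]; B. Perrin-Riou, Ann. Inst. Fourier 43 (1993) §3.3 [PerrinRiou1993AIF]; R. L.
Miller, LMS JCM 14 (2011) Def. 1.1 [Miller2011LMS].
-/

set_option autoImplicit false

noncomputable section

open scoped Classical

open WeierstrassCurve Literature.NumberTheory.EllipticCurves
  Literature.NumberTheory.EllipticCurves.Rank1Residual
  Literature.NumberTheory.EllipticCurves.Rank1Residual.Typed
  Literature.NumberTheory.EllipticCurves.IwasawaAlgebra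

namespace Summit.BirchSwinnertonDyer.Rank1Residual.Additive

variable {IsOf : ∀ (W : WeierstrassCurve ℚ) [W.IsElliptic] [W.IsGloballyMinimal] (p : ℕ) [Fact p.Prime],
  KatoDescentDatum p → Prop}
variable {KMC : ∀ (W : WeierstrassCurve ℚ) [W.IsElliptic] [W.IsGloballyMinimal] (p : ℕ), Prop}

/-- **Thm. 14.5 (3) on a datum without an `L`-value (tree theorem
`Kato2004.exists_index_zeta_eq_pow_mul_natCard_coinvariants_of_index_ne_zero`):** if the zeta element
survives at the bottom layer (`D.zetaIndex ≠ 0`) and `H2/TH2` is finite, the divisibility of Thm. 12.5 (4)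
gives `D.zetaIndex = p^m · D.h2Card` for some `m`. [cite: Kato2004Asterisque, Thm. 14.5 (3) (p. 236), Thm. 12.5 (4) (p. 222)] -/
theorem KatoDescentDatum.exists_zetaIndex_eq_pow_mul {p : ℕ} [Fact p.Prime] (D : KatoDescentDatum p)
    (hfin : Finite (coinvariants p D.H2)) (hdiv : D.Divisibility) (hz : D.zetaIndex ≠ 0) :
    ∃ m : ℕ, D.zetaIndex = p ^ m * D.h2Card :=
  Kato2004.exists_index_zeta_eq_pow_mul_natCard_coinvariants_of_index_ne_zero D.z D.z_ne_zero
    D.isTorsion_quotient D.isTorsion_H2 hdiv D.ι D.π D.ι_injective D.π_surjective D.exact_ι_π hfin hz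

/-- **Rank one: KMC⁰ ⇒ BSD_p (both halves)** at an odd additive potentially good `p` under (12.5.2),
GRANTED the rank-`1` PR count schema (which contains T-O6-A1′) — NO `p`-adic height. Conj. 12.10⁰ gives
`[H¹(ℤ[1/p],T) : z] = #H²` (the zeta element survives — Perrin-Riou's non-vanishing — and `m = 0`), and
the schema at `m = 0` is `ord_p #Ш_an = ord_p #Ш`.
[cite: Kato2004Asterisque, Conj. 12.10 (p. 224), §14.14 (p. 243)] [cite: PerrinRiou1993AIF, §3.3] -/
theorem rankOne_missingPPartAt_of_kmc_of_readings (hR : RankOnePRCountReading IsOf)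
    (hreal : Realizable IsOf) (hread : ReadsTrivialKMC IsOf KMC)
    (hGZK : rank_eq_analyticRank_of_analyticRank_le_one)
    (W : WeierstrassCurve ℚ) [W.IsElliptic] [W.IsGloballyMinimal] (p : ℕ) [Fact p.Prime]
    (hr : W.analyticRank = 1) (hp : p ≠ 2) (hadd : Addv W p) (hj : 0 ≤ padicValRat p W.j)
    (hK : Kato2004.ImageContainsSL2 W p) (hKMC : KMC W p) : MissingPPartAt W p := by
  have hfin : Finite W.sha := (hGZK W (by rw [hr])).2
  obtain ⟨D, hDof⟩ := hreal W p hp hadd hj hK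
  obtain ⟨hfinH2, hcount⟩ := hR W p D hr hp hadd hj hK hfin hDof
  have hμ : D.zetaIndex = D.h2Card :=
    D.zetaIndex_eq_h2Card_of_conj1210 hfinH2 ((hread W p D hDof).mp hKMC)
  obtain ⟨q, hq, hv⟩ := hcount 0 (by rw [pow_zero, one_mul]; exact hμ)
  have hsha : padicValNat p (Nat.card (AddCommGroup.primaryComponent W.sha p)) =
      padicValNat p W.shaOrder := by
    unfold WeierstrassCurve.shaOrder
    exact padicValNat_card_addPrimaryComponent p
  rw [hsha] at hv
  exact ⟨q, hq, by rw [← hv]; simp⟩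

/-- **Rank one, the converse: BSD_p's LOWER half ⇒ Conj. 12.10 on the trivial component for every
realised datum whose zeta element survives at the bottom layer** (`D.zetaIndex ≠ 0` — Perrin-Riou's
non-vanishing, part of T-O6-A1′ at an additive `p`); uses the schema, Thm. 12.5 (4) (Reading 2) and
the tree's module-theoretic Thm. 14.5 (3) and converse descent.
[cite: Kato2004Asterisque, Conj. 12.10 (p. 224), Thm. 12.5 (4) (p. 222), Thm. 14.5 (3) (p. 236)] [cite: PerrinRiou1993AIF, §3.3] -/
theorem rankOne_conj1210_of_missingLowerBoundAt_of_readings (hR : RankOnePRCountReading IsOf)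
    (hdiv : DivisibilityReading IsOf) (hGZK : rank_eq_analyticRank_of_analyticRank_le_one)
    (W : WeierstrassCurve ℚ) [W.IsElliptic] [W.IsGloballyMinimal] (p : ℕ) [Fact p.Prime]
    (D : KatoDescentDatum p) (hr : W.analyticRank = 1) (hp : p ≠ 2) (hadd : Addv W p)
    (hj : 0 ≤ padicValRat p W.j) (hK : Kato2004.ImageContainsSL2 W p) (hDof : IsOf W p D)
    (hz : D.zetaIndex ≠ 0) (hlow : MissingLowerBoundAt W p) : D.Conj1210 := by
  have hfin : Finite W.sha := (hGZK W (by rw [hr])).2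
  obtain ⟨hfinH2, hcount⟩ := hR W p D hr hp hadd hj hK hfin hDof
  have hD := hdiv W p D hp hadd hj hK hDof
  obtain ⟨m, hm⟩ := D.exists_zetaIndex_eq_pow_mul hfinH2 hD hz
  obtain ⟨q, hq, hv⟩ := hcount m hm
  have hsha : padicValNat p (Nat.card (AddCommGroup.primaryComponent W.sha p)) =
      padicValNat p W.shaOrder := by
    unfold WeierstrassCurve.shaOrder
    exact padicValNat_card_addPrimaryComponent p
  rw [hsha] at hv
  -- the lower bound pins `m = 0` (the rational value of `#Ш_an` is unique)
  obtain ⟨-, hiff⟩ := missingLowerBoundAt_iff_of_shaAn_eq W p hq (by rw [← hv])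
  have hm0 : m = 0 := hiff.mp hlow
  rw [hm0, pow_zero, one_mul] at hm
  exact D.conj1210_of_zetaIndex_eq_h2Card hfinH2 hD hm

/-- **Rank one: `KMC W p ↔ MissingLowerBoundAt W p` for a realised datum with surviving zeta element**
(both directions assembled; the `→` direction holds for any realisation).
[cite: Kato2004Asterisque, Conj. 12.10 (p. 224), Thm. 12.5 (4) (p. 222)] [cite: PerrinRiou1993AIF, §3.3] -/
theorem rankOne_kmc_iff_missingLowerBoundAt_of_readings (hR : RankOnePRCountReading IsOf)
    (hdiv : DivisibilityReading IsOf) (hreal : Realizable IsOf) (hread : ReadsTrivialKMC IsOf KMC)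
    (hGZK : rank_eq_analyticRank_of_analyticRank_le_one)
    (W : WeierstrassCurve ℚ) [W.IsElliptic] [W.IsGloballyMinimal] (p : ℕ) [Fact p.Prime]
    (D : KatoDescentDatum p) (hr : W.analyticRank = 1) (hp : p ≠ 2) (hadd : Addv W p)
    (hj : 0 ≤ padicValRat p W.j) (hK : Kato2004.ImageContainsSL2 W p) (hDof : IsOf W p D)
    (hz : D.zetaIndex ≠ 0) : KMC W p ↔ MissingLowerBoundAt W p :=
  ⟨fun h ↦ (lower_and_upper_of_missingPPartAt W p
      (rankOne_missingPPartAt_of_kmc_of_readings hR hreal hread hGZK W p hr hp hadd hj hK h)).1,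
    fun h ↦ (hread W p D hDof).mpr
      (rankOne_conj1210_of_missingLowerBoundAt_of_readings hR hdiv hGZK W p D hr hp hadd hj hK hDof hz h)⟩

/-- **`BSD(E,p)` in analytic rank one from `KMC⁰` over the readings** (Miller's `BSDp`).
[cite: Kato2004Asterisque, Conj. 12.10 (p. 224)] [cite: Miller2011LMS, Def. 1.1] -/
theorem rankOne_bsdp_of_kmc_of_readings (hR : RankOnePRCountReading IsOf) (hreal : Realizable IsOf)
    (hread : ReadsTrivialKMC IsOf KMC) (hGZK : rank_eq_analyticRank_of_analyticRank_le_one)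
    (W : WeierstrassCurve ℚ) [W.IsElliptic] [W.IsGloballyMinimal] (p : ℕ) [Fact p.Prime]
    (hr : W.analyticRank = 1) (hp : p ≠ 2) (hadd : Addv W p) (hj : 0 ≤ padicValRat p W.j)
    (hK : Kato2004.ImageContainsSL2 W p) (hKMC : KMC W p) : BSDp W p :=
  bsdp_of_missingPPartAt W p hGZK (by rw [hr])
    (rankOne_missingPPartAt_of_kmc_of_readings hR hreal hread hGZK W p hr hp hadd hj hK hKMC)

end Summit.BirchSwinnertonDyer.Rank1Residual.Additive

end
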